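import Summits.BirchSwinnertonDyer.BirchSwinnertonDyer.Theorems.AdditiveBranchIMCMultLowerBranchTransport
import Summits.BirchSwinnertonDyer.Rank1Residual.Additive.PotMultRatMainConjLowerBoundOdd
import Summits.BirchSwinnertonDyer.Rank1Residual.AdditivePotMult.PotMultRankOneWuthrichCertificate
import HarnessLib

/-!
# Route `AdditiveBranchIMC` (rung K1), crux `MultLower` (item `stmt-BirchSwinnertonDyer-19359`):
# the branch transport on cell (M) — CLASS theorems and the rank-`0` lower half

Sequel of `AdditiveBranchIMCMultLowerBranchTransport.lean` (the Burungale–Castella–Skinner two-member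
squeeze `{V, E = V^{(p*)}}`, per datum). Here: the class level on the two halves of cell (M) —
X4(M) ∩ {ρ̄_{E,p} onto} (E-side Kato half = Kato 2004 Thm. 17.4 (3), tree brick
`AdditivePotMult.isTorsion_and_exists_iota_eq_of_katoHalf`, fact `hK`) and X3♯(M) (E-side half =
Wuthrich 2014 Thm. 16, brick `…_of_wuthrichHalf`, fact `hW16`) — with the two DISPLAYED inputs
quantified over every globally minimal multiplicative twist model `V` (`C • V^{(p*)} = W`), every newform
`f` of `V`, every cyclotomic datum, every dual datum `DV` of `V`, at THE `p`-adic `L`-function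
`L = L_p(V,T)` (`IsMultPAdicLFunctionOf f p a_p L`; it exists in the tree):
  (KV) `∃ a, ∃ h ∈ char X(V/ℚ_∞)`, `ι(X^e·h) = p^a·L` (Kato's direction for `V`, trivial branch,
       rational, strict Selmer group, `e = 1` iff `V` split at `p` — Kato 17.4 / Skinner 2016 Thm. A
       §3.2 on the (irr)+(ram) rows);
  (BC) `∃ m n G`, `ι(X^e·G) = p^n·L·L^±_br` and `p^m·char X(V/ℚ_∞)·char X(E/ℚ_∞) ⊆ (G)` (the
       base-change lower bound for `V` over `K = ℚ(√p*)`, descended; `p` RAMIFIED in `K`: NOT IN PRINT —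
       the ONE typed Λ-level object of cell (M) in this currency).
Outputs: `ClassX4M/ClassX3M.chiBranchRatCharEqMult_of_katoV_of_baseChangeLower` —
`(p ≡ 1 (4) → ChiBranchRatCharEqMultAt W p) ∧ (p ≡ 3 (4) → ChiBranchRatCharEqMultOddAt W p)` (the
tree's typed RATIONAL `ω^{(p−1)/2}`-branch main conjecture of the multiplicative twist, n1011-p06) —
and the rank-`0` LOWER half `MissingLowerBoundAt W p` on both classes from (KV) + (BC) + ONE unit
coefficient of `ϖ·L^±_br` (the finite `μ = 0` certificate of `MultBranchUnitCoeffCert` /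
`MultOddBranchUnitCoeffCert`) and the published facts `hDelX` (Delbourgo 1998 Prop. 4 (M), exact),
`hPal` (Pal 2012, `p ≡ 1 (4)`), `hGZK`, `hmod`, `hmodD` — through the tree's consumers
`ClassX4M.missingLowerBoundAt_rankZero_of_ratCharEqMult[Odd]_of_unitCoeff` and, on X3♯(M),
`cycLowerLeadingTermAt_of_chiBranchRatCharEqMult[Odd]_of_unitCoeff` ∘
`ClassX3M.missingLowerBoundAt_rankZero_of_cycLeadingTermDvd`. This is `stub_rankZero` of the crux
(= `N10.LowerHalfM`) on cell (M) ∖ {X4(M), ρ̄ not onto} MODULO (KV), (BC) and the certificate; cell (M)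
stays CONSTRUCTION-shaped; nothing booked; no definition, no named fact, no `sorry`.

References: Burungale–Castella–Skinner, IMRN 2025 = arXiv:2405.00270v2 Thm. 1.1.2 (a), §5
[BurungaleCastellaSkinner2025]; Skinner, Pacific J. Math. 283 (2016) Thm. A, §3.2 [Skinner2016PacificMC];
Kato, Astérisque 295 (2004) Thm. 17.4 (3) [Kato2004Asterisque]; Wuthrich, Doc. Math. 19 (2014) Thm. 16
[Wuthrich2014]; Delbourgo, Compositio Math. 113 (1998) Prop. 4, §2.2 Lemma (ii) [Delbourgo1998]; Pal,
Proc. AMS 2012 Thm. 3.2 [Pal2012]; Mazur–Tate–Teitelbaum 1986 §I.10, §I.13–I.14 [MazurTateTeitelbaum1986Invent].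
-/

set_option autoImplicit false
set_option linter.dupNamespace false

noncomputable section

open scoped Classical MatrixGroups ModularForm

namespace Summit.BirchSwinnertonDyer.BirchSwinnertonDyer.Theorems.AdditiveBranchIMCMultLower

open CongruenceSubgroup WeierstrassCurve Literature.NumberTheory.EllipticCurves
  Literature.NumberTheory.EllipticCurves.ModularForms
  Literature.NumberTheory.EllipticCurves.Rank1Residual
  Literature.NumberTheory.EllipticCurves.Rank1Residual.Typed
  Summit.BirchSwinnertonDyer.Rank1Residual.Additive
  Summit.BirchSwinnertonDyer.Rank1Residual.AdditivePotMult

variable (p : ℕ) [hp : Fact p.Prime]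

/-! ### §4 Class level: the rational `χ`-branch main conjecture from (KV) + (BC) -/

/-- **Class level, from a brick provider.** `W = E` globally minimal, additive and potentially
multiplicative at the odd `p` (`AdditivePotMult.PotMult W p`), and a provider `hbricks` of the E-side
brick at every twist-model datum (instantiated below by Kato 17.4 (3) on X4(M) ∩ {ρ̄ onto} and by
Wuthrich Thm. 16 on X3♯(M)). DISPLAYED INPUTS, for every globally minimal multiplicative twist model
`V` (`C • V^{(p*)} = W`), every newform `f` of `V` with `a_p(f) = ap`, every cyclotomic datum and every
dual datum `DV` of `V`, at THE `p`-adic `L`-function `L = L_p(V,T)` (`IsMultPAdicLFunctionOf f p a_p L`,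
which exists in the tree): **(KV)** `∃ a, ∃ h ∈ char X(V/ℚ_∞)`, `ι(X^e·h) = p^a·L` — Kato's direction
for `V` on the trivial branch, rational, strict Selmer group (`e = 1` iff `V` is split at `p`; Kato 2004
Thm. 17.4 / Skinner 2016 Thm. A + §3.2 on the (irr)+(ram) rows); **(BC)** `∃ m n G`,
`ι(X^e·G) = p^n · L · L^±_br` and `p^m · char X(V/ℚ_∞) · char X(E/ℚ_∞) ⊆ (G)` — the base-change lower
bound (Burungale–Castella–Skinner (5.3) shape for the pair `{V, E}`; the descended form of
`char X(V/K·ℚ_∞) ⊆ (L_p(V/K))`, `K = ℚ(√p*)`, `p` RAMIFIED in `K` — NOT IN PRINT). Conclusion: the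
rational `ω^{(p−1)/2}`-branch main conjecture of the multiplicative twist, BOTH parities:
`ChiBranchRatCharEqMultAt W p` (`p ≡ 1 (mod 4)`) and `ChiBranchRatCharEqMultOddAt W p`
(`p ≡ 3 (mod 4)`, `p = 3` included). Cell (M) stays CONSTRUCTION-shaped; nothing booked.
[cite: BurungaleCastellaSkinner2025, Thm. 1.1.2 (a) and its proof (arXiv:2405.00270v2 pp. 2, 10)]
[cite: Skinner2016PacificMC, Thm. A (§1), §3.2] [cite: MazurTateTeitelbaum1986Invent, §I.10, §I.13–I.14] -/
theorem chiBranchRatCharEqMult_of_bricks_of_katoV_of_baseChangeLower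
    {W : WeierstrassCurve ℚ} [W.IsElliptic] [W.IsGloballyMinimal]
    (hbricks : ∀ (V : WeierstrassCurve ℚ) [V.IsElliptic] [V.IsGloballyMinimal] (C : VariableChange ℚ),
      C • V.quadraticTwist ((-1 : ℚ) ^ (p / 2) * p) = W →
      ∀ {κ : ZpExtension ℚ p} {γ : Field.absoluteGaloisGroup ℚ},
        κ.IsCyclotomic → κ.IsTopGenerator γ → IsCyclotomicVariable p γ →
      ∀ {N : ℕ} [NeZero N] {f : CuspForm (Gamma0 N) 2}, IsNewformOf V f →
      ∀ (D : W.SelmerDualData κ γ) (B : PowerSeries ℚ_[p]),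
      ((IsOrdinaryAt V p ∧
          B = if Even (p / 2) then padicLFunctionBranch f ((unitRoot V p : ℤ_[p]) : ℚ_[p]) (p / 2)
            else padicLFunctionMinusBranch f ((unitRoot V p : ℤ_[p]) : ℚ_[p]) (p / 2)) ∨
        (V.HasSplitMultiplicativeReductionAtPrime p ∧
          B = if Even (p / 2) then padicLFunctionPlusBranchMult f (1 : ℚ_[p]) (p / 2)
            else padicLFunctionMinusBranchMult f (1 : ℚ_[p]) (p / 2)) ∨
        (V.HasMultiplicativeReductionAtPrime p ∧ ¬ V.HasSplitMultiplicativeReductionAtPrime p ∧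
          B = if Even (p / 2) then padicLFunctionPlusBranchMult f (-1 : ℚ_[p]) (p / 2)
            else padicLFunctionMinusBranchMult f (-1 : ℚ_[p]) (p / 2))) →
      ∀ (ϖ : ℚ), (if Even (p / 2) then (ϖ : ℝ) * V.realPeriodRat = plusPeriod f
          else (ϖ : ℝ) * V.imaginaryPeriodRat = minusPeriod f) →
      D.IsTorsion ∧ ∃ g ∈ D.charIdeal, ∃ u : ℤ_[p]ˣ,
        iwasawaToPowerSeries p g = PowerSeries.C (((u : ℤ_[p]) : ℚ_[p]) * (ϖ : ℚ_[p])) * B)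
    (hKV : ∀ (V : WeierstrassCurve ℚ) [V.IsElliptic] [V.IsGloballyMinimal] (C : VariableChange ℚ),
      Mult V p → C • V.quadraticTwist ((-1 : ℚ) ^ (p / 2) * p) = W →
      ∀ {N : ℕ} [NeZero N] (f : CuspForm (Gamma0 N) 2), IsNewformOf V f →
      ∀ (ap : ℤ), cuspCoeff f p = ap →
      ∀ (κ : ZpExtension ℚ p) (γ : Field.absoluteGaloisGroup ℚ),
        κ.IsCyclotomic → κ.IsTopGenerator γ → IsCyclotomicVariable p γ →
      ∀ (DV : V.SelmerDualData κ γ) (L : PowerSeries ℚ_[p]),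
        IsMultPAdicLFunctionOf f p ((ap : ℤ) : ℚ_[p]) L →
        ∃ (a : ℕ) (h : IwasawaAlgebra p), h ∈ DV.charIdeal ∧
          iwasawaToPowerSeries p
              (PowerSeries.X ^ (if V.HasSplitMultiplicativeReductionAtPrime p then 1 else 0) * h) =
            PowerSeries.C ((p : ℚ_[p]) ^ a) * L)
    (hBC : ∀ (V : WeierstrassCurve ℚ) [V.IsElliptic] [V.IsGloballyMinimal] (C : VariableChange ℚ),
      Mult V p → C • V.quadraticTwist ((-1 : ℚ) ^ (p / 2) * p) = W →
      ∀ {N : ℕ} [NeZero N] (f : CuspForm (Gamma0 N) 2), IsNewformOf V f →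
      ∀ (ap : ℤ), cuspCoeff f p = ap →
      ∀ (κ : ZpExtension ℚ p) (γ : Field.absoluteGaloisGroup ℚ),
        κ.IsCyclotomic → κ.IsTopGenerator γ → IsCyclotomicVariable p γ →
      ∀ (DV : V.SelmerDualData κ γ) (D : W.SelmerDualData κ γ) (L : PowerSeries ℚ_[p]),
        IsMultPAdicLFunctionOf f p ((ap : ℤ) : ℚ_[p]) L →
        ∃ (m n : ℕ) (G : IwasawaAlgebra p),
          iwasawaToPowerSeries p
              (PowerSeries.X ^ (if V.HasSplitMultiplicativeReductionAtPrime p then 1 else 0) * G) =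
            PowerSeries.C ((p : ℚ_[p]) ^ n) *
              (L * (if Even (p / 2) then padicLFunctionPlusBranchMult f ((ap : ℤ) : ℚ_[p]) (p / 2)
                else padicLFunctionMinusBranchMult f ((ap : ℤ) : ℚ_[p]) (p / 2))) ∧
          ∀ x ∈ DV.charIdeal, ∀ y ∈ D.charIdeal,
            PowerSeries.C ((p : ℤ_[p]) ^ m) * (x * y) ∈ Ideal.span {G}) :
    (p % 4 = 1 → ChiBranchRatCharEqMultAt W p) ∧ (p % 4 = 3 → ChiBranchRatCharEqMultOddAt W p) := by
  refine ⟨fun hp4 ↦ ?_, fun hp4 ↦ ?_⟩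
  · intro V _ _ κ γ N _ f _ hVW hV hκ hγ hcv hf ap hap D ϖ hϖ
    obtain ⟨C, hC⟩ := hVW
    have heven : Even (p / 2) := ⟨p / 4, by omega⟩
    have hC' : C • V.quadraticTwist ((-1 : ℚ) ^ (p / 2) * p) = W := by
      rw [pStar_eq_of_mod_four p (Or.inl hp4), if_pos hp4]; exact hC
    have hϖ' : (if Even (p / 2) then (ϖ : ℝ) * V.realPeriodRat = plusPeriod f
        else (ϖ : ℝ) * V.imaginaryPeriodRat = minusPeriod f) := by
      rw [if_pos heven]; exact hϖ
    obtain ⟨htors, g, k, hspan, hι⟩ :=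
      isTorsion_and_charIdeal_eq_span_branchMult_of_katoV_of_baseChangeLower p V hV hf hap hγ D ϖ hϖ'
        (fun B hdisj ↦ hbricks V C hC' hκ hγ hcv hf D B hdisj ϖ hϖ')
        (fun DV L hL ↦ hKV V C hV hC' f hf ap hap κ γ hκ hγ hcv DV L hL)
        (fun DV L hL ↦ hBC V C hV hC' f hf ap hap κ γ hκ hγ hcv DV D L hL)
    rw [if_pos heven] at hι
    exact ⟨htors, g, k, hspan, hι⟩
  · intro V _ _ κ γ N _ f _ hVW hV hκ hγ hcv hf ap hap D ϖ hϖ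
    obtain ⟨C, hC⟩ := hVW
    have hodd : ¬ Even (p / 2) := by rw [Nat.not_even_iff_odd]; exact ⟨p / 4, by omega⟩
    have hC' : C • V.quadraticTwist ((-1 : ℚ) ^ (p / 2) * p) = W := by
      rw [pStar_eq_of_mod_four p (Or.inr hp4), if_neg (by omega)]; exact hC
    have hϖ' : (if Even (p / 2) then (ϖ : ℝ) * V.realPeriodRat = plusPeriod f
        else (ϖ : ℝ) * V.imaginaryPeriodRat = minusPeriod f) := by
      rw [if_neg hodd]; exact hϖ
    obtain ⟨htors, g, k, hspan, hι⟩ :=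
      isTorsion_and_charIdeal_eq_span_branchMult_of_katoV_of_baseChangeLower p V hV hf hap hγ D ϖ hϖ'
        (fun B hdisj ↦ hbricks V C hC' hκ hγ hcv hf D B hdisj ϖ hϖ')
        (fun DV L hL ↦ hKV V C hV hC' f hf ap hap κ γ hκ hγ hcv DV L hL)
        (fun DV L hL ↦ hBC V C hV hC' f hf ap hap κ γ hκ hγ hcv DV D L hL)
    rw [if_neg hodd] at hι
    exact ⟨htors, g, k, hspan, hι⟩

/-- **X4(M) ∩ {ρ̄_{E,p} onto}, EVERY odd `p`: the rational `χ`-branch main conjecture of the multiplicative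
twist from (KV) + (BC)**, the E-side Kato half being Kato 2004 Thm. 17.4 (3) BY NAME (`hK`, half-eigenspace
reading; tower surjectivity of the twist model from `Surj W p` by `PotMult.towerSurj_twist_of_surj`).
The ONE unprinted input is (BC) ((KV) is Kato/Skinner on the (irr)+(ram) rows of `V`). With the tree's
consumers `ClassX4M.missingLowerBoundAt_rankZero_of_ratCharEqMult[Odd]_of_unitCoeff` this is the
rank-`0` LOWER half on X4(M) modulo (KV), (BC) and ONE unit coefficient (file
`AdditiveBranchIMCMultLowerRankZero.lean`). X4(M) stays CONSTRUCTION-shaped; nothing booked.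
[cite: Kato2004Asterisque, Thm. 17.4 (3) (p. 273)] [cite: BurungaleCastellaSkinner2025, Thm. 1.1.2 (a) (shape)]
[cite: Skinner2016PacificMC, Thm. A (§1), §3.2 (shape of (KV))] -/
theorem ClassX4M.chiBranchRatCharEqMult_of_katoV_of_baseChangeLower
    {W : WeierstrassCurve ℚ} [W.IsElliptic] [W.IsGloballyMinimal]
    (hK : Wuthrich2014.kato_halfEigenCharIdeal_dvd_cyclotomicPrime_of_surjective)
    (hX : ClassX4M W p) (hsurj : Surj W p)
    (hKV : ∀ (V : WeierstrassCurve ℚ) [V.IsElliptic] [V.IsGloballyMinimal] (C : VariableChange ℚ),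
      Mult V p → C • V.quadraticTwist ((-1 : ℚ) ^ (p / 2) * p) = W →
      ∀ {N : ℕ} [NeZero N] (f : CuspForm (Gamma0 N) 2), IsNewformOf V f →
      ∀ (ap : ℤ), cuspCoeff f p = ap →
      ∀ (κ : ZpExtension ℚ p) (γ : Field.absoluteGaloisGroup ℚ),
        κ.IsCyclotomic → κ.IsTopGenerator γ → IsCyclotomicVariable p γ →
      ∀ (DV : V.SelmerDualData κ γ) (L : PowerSeries ℚ_[p]),
        IsMultPAdicLFunctionOf f p ((ap : ℤ) : ℚ_[p]) L →
        ∃ (a : ℕ) (h : IwasawaAlgebra p), h ∈ DV.charIdeal ∧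
          iwasawaToPowerSeries p
              (PowerSeries.X ^ (if V.HasSplitMultiplicativeReductionAtPrime p then 1 else 0) * h) =
            PowerSeries.C ((p : ℚ_[p]) ^ a) * L)
    (hBC : ∀ (V : WeierstrassCurve ℚ) [V.IsElliptic] [V.IsGloballyMinimal] (C : VariableChange ℚ),
      Mult V p → C • V.quadraticTwist ((-1 : ℚ) ^ (p / 2) * p) = W →
      ∀ {N : ℕ} [NeZero N] (f : CuspForm (Gamma0 N) 2), IsNewformOf V f →
      ∀ (ap : ℤ), cuspCoeff f p = ap →
      ∀ (κ : ZpExtension ℚ p) (γ : Field.absoluteGaloisGroup ℚ),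
        κ.IsCyclotomic → κ.IsTopGenerator γ → IsCyclotomicVariable p γ →
      ∀ (DV : V.SelmerDualData κ γ) (D : W.SelmerDualData κ γ) (L : PowerSeries ℚ_[p]),
        IsMultPAdicLFunctionOf f p ((ap : ℤ) : ℚ_[p]) L →
        ∃ (m n : ℕ) (G : IwasawaAlgebra p),
          iwasawaToPowerSeries p
              (PowerSeries.X ^ (if V.HasSplitMultiplicativeReductionAtPrime p then 1 else 0) * G) =
            PowerSeries.C ((p : ℚ_[p]) ^ n) *
              (L * (if Even (p / 2) then padicLFunctionPlusBranchMult f ((ap : ℤ) : ℚ_[p]) (p / 2)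
                else padicLFunctionMinusBranchMult f ((ap : ℤ) : ℚ_[p]) (p / 2))) ∧
          ∀ x ∈ DV.charIdeal, ∀ y ∈ D.charIdeal,
            PowerSeries.C ((p : ℤ_[p]) ^ m) * (x * y) ∈ Ideal.span {G}) :
    (p % 4 = 1 → ChiBranchRatCharEqMultAt W p) ∧ (p % 4 = 3 → ChiBranchRatCharEqMultOddAt W p) :=
  chiBranchRatCharEqMult_of_bricks_of_katoV_of_baseChangeLower p
    (fun V _ _ C hC _ _ hκ hγ hcv _ _ _ hf D B hdisj ϖ hϖ ↦
      isTorsion_and_exists_iota_eq_of_katoHalf hK hX.p_ne_two V C hC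
        ((ClassX4M.potMult W p hX).towerSurj_twist_of_surj hX.p_ne_two hsurj V C hC) hκ hγ hcv hf D B
        hdisj ϖ hϖ)
    hKV hBC

/-- **X3♯(M) (reducible `E[p]`), EVERY odd `p`: the rational `χ`-branch main conjecture of the
multiplicative twist from (KV) + (BC)**, the E-side half being Wuthrich 2014 Thm. 16 BY NAME (`hW16`,
half-eigenspace reading; `V[p]` reducible by `irr_iff_of_model_twist`). NO image hypothesis. X3♯(M) stays
CONSTRUCTION-shaped; nothing booked. [cite: Wuthrich2014, Thm. 16 (p. 397)]
[cite: BurungaleCastellaSkinner2025, Thm. 1.1.2 (a) (shape)] [cite: Skinner2016PacificMC, §3.2 (shape of (KV))] -/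
theorem ClassX3M.chiBranchRatCharEqMult_of_katoV_of_baseChangeLower
    {W : WeierstrassCurve ℚ} [W.IsElliptic] [W.IsGloballyMinimal]
    (hW16 : Wuthrich2014.thm16_halfEigenCharIdeal_dvd_cyclotomicPrime)
    (hX : ClassX3M W p)
    (hKV : ∀ (V : WeierstrassCurve ℚ) [V.IsElliptic] [V.IsGloballyMinimal] (C : VariableChange ℚ),
      Mult V p → C • V.quadraticTwist ((-1 : ℚ) ^ (p / 2) * p) = W →
      ∀ {N : ℕ} [NeZero N] (f : CuspForm (Gamma0 N) 2), IsNewformOf V f →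
      ∀ (ap : ℤ), cuspCoeff f p = ap →
      ∀ (κ : ZpExtension ℚ p) (γ : Field.absoluteGaloisGroup ℚ),
        κ.IsCyclotomic → κ.IsTopGenerator γ → IsCyclotomicVariable p γ →
      ∀ (DV : V.SelmerDualData κ γ) (L : PowerSeries ℚ_[p]),
        IsMultPAdicLFunctionOf f p ((ap : ℤ) : ℚ_[p]) L →
        ∃ (a : ℕ) (h : IwasawaAlgebra p), h ∈ DV.charIdeal ∧
          iwasawaToPowerSeries p
              (PowerSeries.X ^ (if V.HasSplitMultiplicativeReductionAtPrime p then 1 else 0) * h) =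
            PowerSeries.C ((p : ℚ_[p]) ^ a) * L)
    (hBC : ∀ (V : WeierstrassCurve ℚ) [V.IsElliptic] [V.IsGloballyMinimal] (C : VariableChange ℚ),
      Mult V p → C • V.quadraticTwist ((-1 : ℚ) ^ (p / 2) * p) = W →
      ∀ {N : ℕ} [NeZero N] (f : CuspForm (Gamma0 N) 2), IsNewformOf V f →
      ∀ (ap : ℤ), cuspCoeff f p = ap →
      ∀ (κ : ZpExtension ℚ p) (γ : Field.absoluteGaloisGroup ℚ),
        κ.IsCyclotomic → κ.IsTopGenerator γ → IsCyclotomicVariable p γ →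
      ∀ (DV : V.SelmerDualData κ γ) (D : W.SelmerDualData κ γ) (L : PowerSeries ℚ_[p]),
        IsMultPAdicLFunctionOf f p ((ap : ℤ) : ℚ_[p]) L →
        ∃ (m n : ℕ) (G : IwasawaAlgebra p),
          iwasawaToPowerSeries p
              (PowerSeries.X ^ (if V.HasSplitMultiplicativeReductionAtPrime p then 1 else 0) * G) =
            PowerSeries.C ((p : ℚ_[p]) ^ n) *
              (L * (if Even (p / 2) then padicLFunctionPlusBranchMult f ((ap : ℤ) : ℚ_[p]) (p / 2)
                else padicLFunctionMinusBranchMult f ((ap : ℤ) : ℚ_[p]) (p / 2))) ∧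
          ∀ x ∈ DV.charIdeal, ∀ y ∈ D.charIdeal,
            PowerSeries.C ((p : ℤ_[p]) ^ m) * (x * y) ∈ Ideal.span {G}) :
    (p % 4 = 1 → ChiBranchRatCharEqMultAt W p) ∧ (p % 4 = 3 → ChiBranchRatCharEqMultOddAt W p) :=
  chiBranchRatCharEqMult_of_bricks_of_katoV_of_baseChangeLower p
    (fun V _ _ C hC _ _ hκ hγ hcv _ _ _ hf D B hdisj ϖ hϖ ↦
      isTorsion_and_exists_iota_eq_of_wuthrichHalf hW16 (ClassX3M.p_ne_two W p hX) V C hC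
        (fun hirrV ↦ hX.1.1 ((irr_iff_of_model_twist (W := V) (pStar_ne_zero p) ⟨C, hC⟩).mpr hirrV))
        hκ hγ hcv hf D B hdisj ϖ hϖ)
    hKV hBC

end Summit.BirchSwinnertonDyer.BirchSwinnertonDyer.Theorems.AdditiveBranchIMCMultLower

end
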